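import Summits.KontsevichZagierPeriods.KontsevichZagierPeriods.Theorems.SymplecticScissorsVolumeFormOffPlaneMatrixPowerMove
import Summits.KontsevichZagierPeriods.KontsevichZagierPeriods.Theorems.SymplecticScissorsVolumeFormOffPlaneLogBoxCut
import Summits.KontsevichZagierPeriods.KontsevichZagierPeriods.Theorems.SymplecticScissorsVolumeFormOffPlaneMixedSector

/-!
# `VolumeFormOffPlane` (stmt-KontsevichZagierPeriods-14935) — line `Sketch`,
stub `stub_parallelepipedCertificate` (the parallelepiped certificate, `d = |det M|`)

Box dimension `n`, total dimension `n + 1`: box coordinates `x_j = p (Fin.castSucc j)`, slack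
`z = p (Fin.last n)`. For `M ∈ ℤ^{n×n}` with `det M ≠ 0`, a positive real-algebraic corner
`a : Fin n → ℝ` and edge ratios `g_k = α^{u_k} β^{v_k} > 1` (`α, β > 0` real algebraic,
`u, v ∈ ℚⁿ`), the LOG-PARALLELEPIPED is the cell
`{x > 0, a_k < ∏_j x_j^{M k j} < a_k g_k (k < n), 0 < z, z ∏ x_j < 1}`,
i.e. the preimage of the Λ-box `B(a, a·g) = {a_k < ξ_k < a_k g_k, 0 < z', z' ∏ ξ_k < 1}` under the
matrix power map `Φ_M (x, z) = ((∏_j x_j^{M k j})_k, z ∏ x / ∏_k ∏_j x_j^{M k j})` (the slack is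
rescaled so that `z' ∏ ξ = z ∏ x`).

An integrand-`1` representation `ρ` on the log-parallelepiped carries the TORSION CERTIFICATE
`|det M| • [ρ] − [σ₀] ∈ KZ.relations` with `σ₀` an integrand-`1` representation of the Λ-box:
* `σ₀` exists by the landed `stub_logBoxCut` (part 1: log-boxes with positive real-algebraic
  corners carry integrand-`1` representations; the upper corner `a_k α^{u_k} β^{v_k}` is algebraic
  since rational powers of positive real algebraic numbers are algebraic, `mxs_rpow_isAlgebraic` of
  the landed sibling `…MixedSector.lean`);
* the landed `stub_matrixPowerMove` (part 2: the matrix power map is ONE rule-(2) move of constant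
  Jacobian `|det M|`, followed by integrand additivity) gives `[σ₀] − |det M| • [ρ] ∈ KZ.relations`
  once membership is transported by `Φ_M`, which is the definition of the cell (the slack
  conditions agree because `∏_k (Φ_M p)_k = ∏_k ∏_j x_j^{M k j} > 0`).

These are the first cells of the certified sector whose certificate genuinely needs `d > 1`.

Sources: M. Kontsevich, D. Zagier, *Periods* (2001), §1.2 rules (1), (2). The bookkeeping is
folklore; the membership computation follows the landed sibling
`…/Theorems/SymplecticScissorsVolumeFormOffPlaneBinomialCellToBox.lean`.
-/

noncomputable section

open MeasureTheory Set
open Literature.NumberTheory.Transcendental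

namespace Summit.KontsevichZagierPeriods.SymplecticScissors.LogPolytope

/-- **Membership transport along the matrix power map.** On the open orthant `{x_j > 0}`, a point
lies in the log-parallelepipied over `(a, b)` iff its image under `Φ_M` lies in the log-box
`B(a, b)`: the box conditions are literally the monomial conditions, and the slack conditions agree
since `z' = z ∏ x / P` with `P = ∏_k ∏_j x_j^{M k j} = ∏_k (Φ_M p)_k > 0`. [folklore] -/
theorem pllc_mem_iff {n : ℕ} (M : Matrix (Fin n) (Fin n) ℤ) (a b : Fin n → ℝ)
    (p : Fin (n + 1) → ℝ) (hpos : ∀ ι : Fin n, 0 < p (Fin.castSucc ι)) :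
    p ∈ {p : Fin (n + 1) → ℝ | (∀ ι : Fin n, 0 < p (Fin.castSucc ι)) ∧
        (∀ k : Fin n, a k < ∏ j : Fin n, p (Fin.castSucc j) ^ (M k j) ∧
          ∏ j : Fin n, p (Fin.castSucc j) ^ (M k j) < b k) ∧
        0 < p (Fin.last n) ∧ p (Fin.last n) * ∏ ι : Fin n, p (Fin.castSucc ι) < 1} ↔
    (Fin.snoc (fun k : Fin n => ∏ j : Fin n, p (Fin.castSucc j) ^ (M k j))
        (p (Fin.last n) * (∏ j : Fin n, p (Fin.castSucc j)) /
          ∏ k : Fin n, ∏ j : Fin n, p (Fin.castSucc j) ^ (M k j)) : Fin (n + 1) → ℝ) ∈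
      {p : Fin (n + 1) → ℝ | (∀ j : Fin n, a j < p (Fin.castSucc j) ∧
        p (Fin.castSucc j) < b j) ∧ 0 < p (Fin.last n) ∧
        p (Fin.last n) * ∏ j : Fin n, p (Fin.castSucc j) < 1} := by
  simp only [mem_setOf_eq, Fin.snoc_castSucc, Fin.snoc_last]
  have hQ : 0 < ∏ k : Fin n, ∏ j : Fin n, p (Fin.castSucc j) ^ (M k j) :=
    Finset.prod_pos fun k _ => Finset.prod_pos fun j _ => zpow_pos (hpos j) _
  have hX : 0 < ∏ j : Fin n, p (Fin.castSucc j) := Finset.prod_pos fun j _ => hpos j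
  have e4 : 0 < p (Fin.last n) * (∏ j, p (Fin.castSucc j)) /
      ∏ k, ∏ j, p (Fin.castSucc j) ^ (M k j) ↔ 0 < p (Fin.last n) := by
    rw [div_pos_iff_of_pos_right hQ, mul_pos_iff_of_pos_right hX]
  have e5 : p (Fin.last n) * (∏ j, p (Fin.castSucc j)) /
      (∏ k, ∏ j, p (Fin.castSucc j) ^ (M k j)) * ∏ k, ∏ j, p (Fin.castSucc j) ^ (M k j) =
      p (Fin.last n) * ∏ j, p (Fin.castSucc j) := div_mul_cancel₀ _ hQ.ne'
  rw [e4, e5]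
  exact ⟨fun h => h.2, fun h => ⟨hpos, h⟩⟩

/-- **Stub v6-11 (PARALLELEPIPED CERTIFICATE, `d = |det M|`).** An integrand-`1` representation on
a Λ-rational log-parallelepiped `{x > 0, a_k < x^{M_k} < a_k·α^{u_k}β^{v_k}}` (`M ∈ ℤ^{n×n}`,
`det M ≠ 0`; the preimage of a Λ-box under the monomial map `x ↦ x^M`) carries the torsion
certificate `|det M| • [cell] ≡ [box]` (landed `stub_matrixPowerMove`: the monomial map is ONE
rule-(2) move of Jacobian `|det M|`; box representations exist by `stub_logBoxCut`). The first
cells of the sector whose certificate genuinely needs `d > 1`. [folklore] -/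
theorem stub_parallelepipedCertificate : ∀ (n : ℕ) (α β : ℝ), 0 < α → 0 < β → IsAlgebraic ℚ α → IsAlgebraic ℚ β →
    ∀ (M : Matrix (Fin n) (Fin n) ℤ) (a : Fin n → ℝ) (u v : Fin n → ℚ) (ρ : KZ.IntegralRep (n + 1)),
    M.det ≠ 0 → (∀ ι, 0 < a ι) → (∀ ι, IsAlgebraic ℚ (a ι)) →
    (∀ ι, 1 < α ^ ((u ι : ℚ) : ℝ) * β ^ ((v ι : ℚ) : ℝ)) →
    ρ.domain = {p : Fin (n + 1) → ℝ | (∀ ι : Fin n, 0 < p (Fin.castSucc ι)) ∧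
        (∀ k : Fin n, a k < ∏ j : Fin n, p (Fin.castSucc j) ^ (M k j) ∧
          ∏ j : Fin n, p (Fin.castSucc j) ^ (M k j) < a k * (α ^ ((u k : ℚ) : ℝ) * β ^ ((v k : ℚ) : ℝ))) ∧
        0 < p (Fin.last n) ∧ p (Fin.last n) * ∏ ι : Fin n, p (Fin.castSucc ι) < 1} →
    (∀ p ∈ ρ.domain, ρ.integrand p = 1) →
    ∃ (d l : ℕ) (σ : Fin l → KZ.IntegralRep (n + 1)) (w : Fin l → ℤ), d ≠ 0 ∧
        (∀ j, w j ≠ 0 → ∃ (a : Fin (n) → ℝ) (u v : Fin (n) → ℚ),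
          (∀ ξ ∈ (σ j).domain, (σ j).integrand ξ = 1) ∧ (∀ ι, 0 < a ι) ∧
          (∀ ι, IsAlgebraic ℚ (a ι)) ∧ (∀ ι, 1 < α ^ ((u ι : ℚ) : ℝ) * β ^ ((v ι : ℚ) : ℝ)) ∧
          (σ j).domain = {ξ : Fin (n + 1) → ℝ | (∀ ι : Fin (n), a ι < ξ (Fin.castSucc ι) ∧
            ξ (Fin.castSucc ι) < a ι * (α ^ ((u ι : ℚ) : ℝ) * β ^ ((v ι : ℚ) : ℝ))) ∧
            0 < ξ (Fin.last (n)) ∧ ξ (Fin.last (n)) * ∏ ι : Fin (n), ξ (Fin.castSucc ι) < 1}) ∧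
        d • KZ.of ρ - ∑ j, w j • KZ.of (σ j) ∈ KZ.relations := by
  intro n α β hα hβ hαa hβa M a u v ρ hM ha haa hg hρd hρ1
  -- the Λ-box `B(a, a·g)` carries an integrand-`1` representation
  obtain ⟨r', hr'd, hr'i⟩ : ∃ r' : KZ.IntegralRep (n + 1),
      r'.domain = {ξ : Fin (n + 1) → ℝ | (∀ ι : Fin n, a ι < ξ (Fin.castSucc ι) ∧
        ξ (Fin.castSucc ι) < a ι * (α ^ ((u ι : ℚ) : ℝ) * β ^ ((v ι : ℚ) : ℝ))) ∧
        0 < ξ (Fin.last n) ∧ ξ (Fin.last n) * ∏ ι : Fin n, ξ (Fin.castSucc ι) < 1} ∧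
      r'.integrand = fun _ => 1 :=
    stub_logBoxCut.1 n a (fun ι => a ι * (α ^ ((u ι : ℚ) : ℝ) * β ^ ((v ι : ℚ) : ℝ))) ha haa
      fun ι => (haa ι).mul
        ((mxs_rpow_isAlgebraic hα hαa (u ι)).mul (mxs_rpow_isAlgebraic hβ hβa (v ι)))
  have hr'1 : ∀ ξ ∈ r'.domain, r'.integrand ξ = 1 := fun ξ _ => by rw [hr'i]
  -- the matrix power move: `[box] - |det M| • [cell] ∈ relations`
  have hrel : KZ.of r' - M.det.natAbs • KZ.of ρ ∈ KZ.relations := by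
    refine (stub_matrixPowerMove n M hM).2 ρ r' ?_ ?_ (fun p hpos => ?_) hρ1 hr'1
    · rw [hρd]
      exact fun p hp => hp.1
    · rw [hr'd]
      exact fun p hp ι => (ha ι).trans (hp.1 ι).1
    · rw [hρd, hr'd]
      exact pllc_mem_iff M a _ p hpos
  refine ⟨M.det.natAbs, 1, fun _ => r', fun _ => 1, Int.natAbs_ne_zero.mpr hM,
    fun _ _ => ⟨a, u, v, hr'1, ha, haa, hg, hr'd⟩, ?_⟩
  have hneg := KZ.relations.neg_mem hrel
  rw [neg_sub] at hneg
  simpa only [Fin.sum_univ_one, one_smul] using hneg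

end Summit.KontsevichZagierPeriods.SymplecticScissors.LogPolytope

end
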